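import Summits.CriticalPhenomena.PercolationContinuityZ3.Theorems.PercNearOneGluingAdditiveGluingKnThm2Good
import Summits.CriticalPhenomena.PercolationContinuityZ3.Theorems.PercNearOneGluingAdditiveGluingBhkSets
import Summits.CriticalPhenomena.PercolationContinuityZ3.Theorems.PercNearOneGluingAdditiveGluingKnLemma2
import HarnessLib

/-! # Crux `PercNearOneGluing.AdditiveGluing` (stmt-CriticalPhenomena-4576) — Kozma–Nitzan's Theorem 2 exchange AT THE DESIGNATION
# (no minimality), and its block form: a closure of the designated-pocket kernel for three relays (seat (d) round 4)

Support file (`--supports stmt-CriticalPhenomena-4576`); no definitions, no named facts.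

KN's proof of Theorem 2 (arXiv:2401.12397 pp. 8–9) bounds `X := μ(o↔A, o↔b) − μ(o↔A, a₃↔b) = I + II + III` by six set-BHK
steps and Lemma 2; NONE of these uses that `a₃` is the worst relay — minimality only enters the final sign argument.  Keeping the
designation `a₃` arbitrary one gets (`knThm2_arith_designated`)
  `P₁ P₂ P₁₂ · X ≥ P₁₂ · [A₁ P₂ (τ₁ − τ₃) + A₂ P₁ (τ₂ − τ₃)]`   (`m₃ ≤ m₁₂`; `Pₖ = μ(Nₖ)`, `Aₖ = μ(Nₖ ∩ {aₖ ↔ o})`),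
so `X ≥ 0` as soon as the CERTIFICATE `A₁ P₂ (τ₁ − τ₃) + A₂ P₁ (τ₂ − τ₃) ≥ 0` holds — the strong relay's advantage may pay for a
relay that is (glued-)BELOW the designated one (`knThm2_designated`; unconditional form `knThm2_designated'`: `stub_bhkSets` and
`stub_knLemma2` are landed).  Block form (`dKernel_three_of_knThm2`): in the glued weighting `u/S` with observer `s₀ ∈ S` this is the
designated-pocket kernel `μ_{u/S}((s₀↔A) ∩ (a₀↔b)) ≤ μ_{u/S}(s₀↔b)` (cf. `additiveGluing_of_dcone`) for three relays.  Census of this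
seat (exact engine, lab/knthm2.py, lab/dcert.py): this closes every member found of the residual wedge of the switch calculus
(lab/surv1–3: certificate +0.0071, +0.0035, +0.0087 with `m₀ ≪ m₁₂`), where `a₀` is glued-above the bridge relay by ≈1e−3 but far
below the strong relay.
[cite: KozmaNitzan2024, Theorem 2 (§3.2, pp. 8–9), Lemma 2 p. 6; VandenbergHaggstromKahn2006, Thms. 1.3–1.4]
-/

namespace Summit.CriticalPhenomena.PercolationContinuityZ3.Theorems

open MeasureTheory Set Literature.Probability.LatticeModels Literature.Probability.Percolation

noncomputable section
open Classical

variable {n : ℕ}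

/-- The real-arithmetic core of Kozma–Nitzan's proof of Theorem 2 AT A GENERAL DESIGNATION: the six BHK bounds, Lemma 2 and
`m₃ ≤ m₁₂` give `P₁ P₂ P₁₂ · (I + II + III) ≥ P₁₂ · [A₁ P₂ (τ₁ − τ₃) + A₂ P₁ (τ₂ − τ₃)]`, so the certificate
`A₁ P₂ (τ₁ − τ₃) + A₂ P₁ (τ₂ − τ₃) ≥ 0` (no minimality of `a₃`) yields `I + II + III ≥ 0` when `P₁, P₂, P₁₂ > 0`.
[cite: KozmaNitzan2024, Theorem 2 (§3.2, p. 9)] -/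
theorem knThm2_arith_designated {T₁₂ U₁₂ T₁ U₁ T₂ U₂ P₁₂ P₁ P₂ A₁₂ A₁ A₂ m₁₂ m₃ m₁ m₂₃ m₂ m₁₃ D₁ D₂ : ℝ}
    (_hT₁₂ : 0 ≤ T₁₂) (_hT₁ : 0 ≤ T₁) (_hT₂ : 0 ≤ T₂)
    (_hU₁₂ : U₁₂ ≤ P₁₂) (_hU₁ : U₁ ≤ P₁) (_hU₂ : U₂ ≤ P₂)
    (hP₁₂ : 0 ≤ P₁₂) (hP₁ : 0 ≤ P₁) (hP₂ : 0 ≤ P₂)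
    (_hA₁₂ : 0 ≤ A₁₂) (_hA₁ : 0 ≤ A₁) (_hA₂ : 0 ≤ A₂)
    (_hm₃ : 0 ≤ m₃) (_hm₁₂ : m₁₂ ≤ P₁₂)
    (h1 : A₁₂ * m₁₂ ≤ P₁₂ * T₁₂) (h2 : P₁₂ * U₁₂ ≤ A₁₂ * m₃)
    (h3 : A₁ * m₁ ≤ P₁ * T₁) (h4 : P₁ * U₁ ≤ A₁ * m₂₃)
    (h5 : A₂ * m₂ ≤ P₂ * T₂) (h6 : P₂ * U₂ ≤ A₂ * m₁₃)
    (hL : A₁ * P₁₂ * P₂ + A₂ * P₁₂ * P₁ ≤ A₁₂ * P₁ * P₂)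
    (hd : m₃ ≤ m₁₂) (hD₁ : D₁ = (m₁₂ + m₁) - (m₂₃ + m₃)) (hD₂ : D₂ = (m₁₂ + m₂) - (m₁₃ + m₃))
    (hcert : 0 ≤ A₁ * P₂ * D₁ + A₂ * P₁ * D₂)
    (hP₁₂' : 0 < P₁₂) (hP₁' : 0 < P₁) (hP₂' : 0 < P₂) :
    0 ≤ (T₁₂ - U₁₂) + (T₁ - U₁) + (T₂ - U₂) := by
  have ha : A₁₂ * (m₁₂ - m₃) ≤ P₁₂ * (T₁₂ - U₁₂) := by linarith
  have hb : A₁ * (m₁ - m₂₃) ≤ P₁ * (T₁ - U₁) := by linarith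
  have hc : A₂ * (m₂ - m₁₃) ≤ P₂ * (T₂ - U₂) := by linarith
  have hP12 : 0 ≤ P₁ * P₂ := mul_nonneg hP₁ hP₂
  have ha' : P₁ * P₂ * (A₁₂ * (m₁₂ - m₃)) ≤ P₁ * P₂ * (P₁₂ * (T₁₂ - U₁₂)) := mul_le_mul_of_nonneg_left ha hP12
  have hb' : P₂ * P₁₂ * (A₁ * (m₁ - m₂₃)) ≤ P₂ * P₁₂ * (P₁ * (T₁ - U₁)) :=
    mul_le_mul_of_nonneg_left hb (mul_nonneg hP₂ hP₁₂)
  have hc' : P₁ * P₁₂ * (A₂ * (m₂ - m₁₃)) ≤ P₁ * P₁₂ * (P₂ * (T₂ - U₂)) :=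
    mul_le_mul_of_nonneg_left hc (mul_nonneg hP₁ hP₁₂)
  have hL'' : (m₁₂ - m₃) * (A₁ * P₁₂ * P₂ + A₂ * P₁₂ * P₁) ≤ (m₁₂ - m₃) * (A₁₂ * P₁ * P₂) :=
    mul_le_mul_of_nonneg_left hL (sub_nonneg.2 hd)
  have hmain : P₁₂ * (A₁ * P₂ * D₁ + A₂ * P₁ * D₂) ≤ P₁ * P₂ * P₁₂ * ((T₁₂ - U₁₂) + (T₁ - U₁) + (T₂ - U₂)) := by
    rw [hD₁, hD₂]; nlinarith [ha', hb', hc', hL'']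
  have hprod : 0 ≤ P₁ * P₂ * P₁₂ * ((T₁₂ - U₁₂) + (T₁ - U₁) + (T₂ - U₂)) :=
    le_trans (mul_nonneg hP₁₂ hcert) hmain
  have hpos : 0 < P₁ * P₂ * P₁₂ := mul_pos (mul_pos hP₁' hP₂') hP₁₂'
  exact (mul_nonneg_iff_of_pos_left hpos).1 hprod

/-- **KN Theorem 2 at a general designation, core inequality** `μ(o↔A, a₃↔b) ≤ μ(o↔A, o↔b)` from the set-BHK inequalities
(`hB1`, `hB2`), Lemma 2 (`hL`), the good-case hypothesis `m₃ ≤ m₁₂`, non-degeneracy `P₁, P₂, P₁₂ > 0` and the CERTIFICATE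
`A₁ P₂ (τ₁ − τ₃) + A₂ P₁ (τ₂ − τ₃) ≥ 0` in place of the minimality of `a₃`.  Proof = KN pp. 8–9 verbatim up to the last line.
[cite: KozmaNitzan2024, Theorem 2 (§3.2, pp. 8–9)] -/
theorem knThm2_designated
    (hB1 : ∀ (n : ℕ) (w : Sym2 (Fin n) → unitInterval) (S : Finset (Fin n)) (X : Set (Fin n))
        (F G : Set (Sym2 (Fin n)) → ℝ), Monotone F → Monotone G → (∀ s ∈ S, s ∉ X) →
        (∫ ω in {ω : BondConfig (Fin n) | ∀ s ∈ S, ∀ x ∈ X, ¬ (openGraph ω).Reachable s x},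
            F (⋃ s ∈ S, openEdgeCluster ω s) ∂(prodBernoulli w)) *
          (∫ ω in {ω : BondConfig (Fin n) | ∀ s ∈ S, ∀ x ∈ X, ¬ (openGraph ω).Reachable s x},
            G (⋃ s ∈ S, openEdgeCluster ω s) ∂(prodBernoulli w)) ≤
        (prodBernoulli w).real
            {ω : BondConfig (Fin n) | ∀ s ∈ S, ∀ x ∈ X, ¬ (openGraph ω).Reachable s x} *
          ∫ ω in {ω : BondConfig (Fin n) | ∀ s ∈ S, ∀ x ∈ X, ¬ (openGraph ω).Reachable s x},
            F (⋃ s ∈ S, openEdgeCluster ω s) * G (⋃ s ∈ S, openEdgeCluster ω s)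
              ∂(prodBernoulli w))
    (hB2 : ∀ (n : ℕ) (w : Sym2 (Fin n) → unitInterval) (S S' : Finset (Fin n))
        (F G : Set (Sym2 (Fin n)) → ℝ), Monotone F → Monotone G → Disjoint S S' →
        (prodBernoulli w).real
            {ω : BondConfig (Fin n) | ∀ s ∈ S, ∀ x ∈ S', ¬ (openGraph ω).Reachable s x} *
          (∫ ω in {ω : BondConfig (Fin n) | ∀ s ∈ S, ∀ x ∈ S', ¬ (openGraph ω).Reachable s x},
            F (⋃ s ∈ S, openEdgeCluster ω s) * G (⋃ s ∈ S', openEdgeCluster ω s)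
              ∂(prodBernoulli w)) ≤
        (∫ ω in {ω : BondConfig (Fin n) | ∀ s ∈ S, ∀ x ∈ S', ¬ (openGraph ω).Reachable s x},
            F (⋃ s ∈ S, openEdgeCluster ω s) ∂(prodBernoulli w)) *
          (∫ ω in {ω : BondConfig (Fin n) | ∀ s ∈ S, ∀ x ∈ S', ¬ (openGraph ω).Reachable s x},
            G (⋃ s ∈ S', openEdgeCluster ω s) ∂(prodBernoulli w)))
    (hL : ∀ (n : ℕ) (w : Sym2 (Fin n) → unitInterval) (o a₁ a₂ a₃ : Fin n),
        a₁ ≠ a₂ → a₁ ≠ a₃ → a₂ ≠ a₃ →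
        (prodBernoulli w).real (openConn o a₁ ∩ ((openConn a₁ a₂)ᶜ ∩ (openConn a₁ a₃)ᶜ)) *
              (prodBernoulli w).real ((openConn a₁ a₃)ᶜ ∩ (openConn a₂ a₃)ᶜ) *
            (prodBernoulli w).real ((openConn a₂ a₁)ᶜ ∩ (openConn a₂ a₃)ᶜ) +
          (prodBernoulli w).real (openConn o a₂ ∩ ((openConn a₂ a₁)ᶜ ∩ (openConn a₂ a₃)ᶜ)) *
              (prodBernoulli w).real ((openConn a₁ a₃)ᶜ ∩ (openConn a₂ a₃)ᶜ) *
            (prodBernoulli w).real ((openConn a₁ a₂)ᶜ ∩ (openConn a₁ a₃)ᶜ) ≤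
        (prodBernoulli w).real
              ((openConn o a₁ ∪ openConn o a₂) ∩ ((openConn a₁ a₃)ᶜ ∩ (openConn a₂ a₃)ᶜ)) *
            (prodBernoulli w).real ((openConn a₁ a₂)ᶜ ∩ (openConn a₁ a₃)ᶜ) *
          (prodBernoulli w).real ((openConn a₂ a₁)ᶜ ∩ (openConn a₂ a₃)ᶜ))
    (w : Sym2 (Fin n) → unitInterval) (o b a₁ a₂ a₃ : Fin n)
    (h12 : a₁ ≠ a₂) (h13 : a₁ ≠ a₃) (h23 : a₂ ≠ a₃)
    (hP₁₂ : 0 < (prodBernoulli w).real ((openConn a₁ a₃)ᶜ ∩ (openConn a₂ a₃)ᶜ : Set (BondConfig (Fin n))))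
    (hP₁ : 0 < (prodBernoulli w).real ((openConn a₁ a₂)ᶜ ∩ (openConn a₁ a₃)ᶜ : Set (BondConfig (Fin n))))
    (hP₂ : 0 < (prodBernoulli w).real ((openConn a₂ a₁)ᶜ ∩ (openConn a₂ a₃)ᶜ : Set (BondConfig (Fin n))))
    (hcert : 0 ≤ (prodBernoulli w).real ((openConn a₁ a₂)ᶜ ∩ (openConn a₁ a₃)ᶜ ∩ openConn a₁ o)
          * (prodBernoulli w).real ((openConn a₂ a₁)ᶜ ∩ (openConn a₂ a₃)ᶜ : Set (BondConfig (Fin n)))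
          * ((prodBernoulli w).real (openConn a₁ b) - (prodBernoulli w).real (openConn a₃ b))
        + (prodBernoulli w).real ((openConn a₂ a₁)ᶜ ∩ (openConn a₂ a₃)ᶜ ∩ openConn a₂ o)
          * (prodBernoulli w).real ((openConn a₁ a₂)ᶜ ∩ (openConn a₁ a₃)ᶜ : Set (BondConfig (Fin n)))
          * ((prodBernoulli w).real (openConn a₂ b) - (prodBernoulli w).real (openConn a₃ b)))
    (hgood : (prodBernoulli w).real (openConn b a₃ ∩ (openConn b a₁)ᶜ ∩ (openConn b a₂)ᶜ) ≤
      (prodBernoulli w).real (openConn b a₁ ∩ openConn b a₂ ∩ (openConn b a₃)ᶜ)) :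
    (prodBernoulli w).real ((openConn o a₁ ∪ openConn o a₂ ∪ openConn o a₃) ∩ openConn a₃ b) ≤
      (prodBernoulli w).real
        ((openConn o a₁ ∪ openConn o a₂ ∪ openConn o a₃) ∩ openConn o b) := by
  -- the six set-BHK bounds (KN p. 9)
  have i1 := knThm2_bhkOne hB1 w {a₁, a₂} ({a₃} : Set (Fin n)) o b (by simp [h13, h23])
  have i2 := knThm2_bhkTwo hB2 w {a₁, a₂} {a₃} o b (by simp [h13.symm, h23.symm])
  have i3 := knThm2_bhkOne hB1 w {a₁} ({a₂, a₃} : Set (Fin n)) o b (by simp [h12, h13])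
  have i4 := knThm2_bhkTwo hB2 w {a₁} {a₂, a₃} o b (by simp [h12, h13])
  have i5 := knThm2_bhkOne hB1 w {a₂} ({a₁, a₃} : Set (Fin n)) o b (by simp [h12.symm, h23])
  have i6 := knThm2_bhkTwo hB2 w {a₂} {a₁, a₃} o b (by simp [h12.symm, h23])
  rw [knThm2_sep_pair_set, Finset.set_biUnion_insert, Finset.set_biUnion_singleton,
    Finset.set_biInter_insert, Finset.set_biInter_singleton] at i1
  rw [knThm2_sep_pair_finset, Finset.set_biUnion_insert, Finset.set_biUnion_singleton,
    Finset.set_biInter_singleton] at i2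
  rw [knThm2_sep_single_set, Finset.set_biUnion_singleton, Finset.set_biInter_singleton] at i3
  rw [knThm2_sep_single_finset, Finset.set_biUnion_singleton, Finset.set_biInter_insert,
    Finset.set_biInter_singleton] at i4
  rw [knThm2_sep_single_set, Finset.set_biUnion_singleton, Finset.set_biInter_singleton] at i5
  rw [knThm2_sep_single_finset, Finset.set_biUnion_singleton, Finset.set_biInter_insert,
    Finset.set_biInter_singleton] at i6
  -- Lemma 2 (KN p. 6), with `{o ↔ aₖ} = {aₖ ↔ o}`
  have hL' := hL n w o a₁ a₂ a₃ h12 h13 h23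
  rw [knThm2_openConn_comm o a₁, knThm2_openConn_comm o a₂,
    Set.inter_comm (openConn a₁ o) ((openConn a₁ a₂)ᶜ ∩ (openConn a₁ a₃)ᶜ),
    Set.inter_comm (openConn a₂ o) ((openConn a₂ a₁)ᶜ ∩ (openConn a₂ a₃)ᶜ),
    Set.inter_comm (openConn a₁ o ∪ openConn a₂ o) ((openConn a₁ a₃)ᶜ ∩ (openConn a₂ a₃)ᶜ)]
    at hL'
  -- `τ₁ − τ₃`, `τ₂ − τ₃` on the atoms, and the good case on the atoms
  have hτ1 := knThm2_tau_sub w b a₁ a₂ a₃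
  have hτ2 := knThm2_tau_sub w b a₂ a₁ a₃
  rw [Set.inter_comm (openConn a₂ a₃)ᶜ (openConn a₁ a₃)ᶜ,
    Set.inter_comm (openConn a₂ b) (openConn a₁ b)] at hτ2
  rw [knThm2_m3, knThm2_m12] at hgood
  -- `X = I + II + III`
  have hA := knThm2_partA w o b a₁ a₂ a₃
  have hB := knThm2_partB w o b a₁ a₂ a₃
  -- trivial bounds
  have hU₁₂ : (prodBernoulli w).real ((openConn a₁ a₃)ᶜ ∩ (openConn a₂ a₃)ᶜ ∩
      ((openConn a₁ o ∪ openConn a₂ o) ∩ openConn a₃ b)) ≤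
      (prodBernoulli w).real ((openConn a₁ a₃)ᶜ ∩ (openConn a₂ a₃)ᶜ : Set (BondConfig (Fin n))) :=
    measureReal_mono Set.inter_subset_left
  have hU₁ : (prodBernoulli w).real ((openConn a₁ a₂)ᶜ ∩ (openConn a₁ a₃)ᶜ ∩
      (openConn a₁ o ∩ (openConn a₂ b ∩ openConn a₃ b))) ≤
      (prodBernoulli w).real ((openConn a₁ a₂)ᶜ ∩ (openConn a₁ a₃)ᶜ : Set (BondConfig (Fin n))) :=
    measureReal_mono Set.inter_subset_left
  have hU₂ : (prodBernoulli w).real ((openConn a₂ a₁)ᶜ ∩ (openConn a₂ a₃)ᶜ ∩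
      (openConn a₂ o ∩ (openConn a₁ b ∩ openConn a₃ b))) ≤
      (prodBernoulli w).real ((openConn a₂ a₁)ᶜ ∩ (openConn a₂ a₃)ᶜ : Set (BondConfig (Fin n))) :=
    measureReal_mono Set.inter_subset_left
  have hm₁₂ : (prodBernoulli w).real ((openConn a₁ a₃)ᶜ ∩ (openConn a₂ a₃)ᶜ ∩
      (openConn a₁ b ∩ openConn a₂ b)) ≤
      (prodBernoulli w).real ((openConn a₁ a₃)ᶜ ∩ (openConn a₂ a₃)ᶜ : Set (BondConfig (Fin n))) :=
    measureReal_mono Set.inter_subset_left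
  have key := knThm2_arith_designated measureReal_nonneg measureReal_nonneg measureReal_nonneg hU₁₂ hU₁ hU₂
    measureReal_nonneg measureReal_nonneg measureReal_nonneg measureReal_nonneg measureReal_nonneg
    measureReal_nonneg measureReal_nonneg hm₁₂ i1 i2 i3 i4 i5 i6 hL' hgood hτ1 hτ2 hcert hP₁₂ hP₁ hP₂
  linarith

/-- **KN Theorem 2 at the designation, unconditional form** (set-BHK `stub_bhkSets` and Lemma 2 `stub_knLemma2` are landed).
[cite: KozmaNitzan2024, Theorem 2 (§3.2, pp. 8–9)] -/
theorem knThm2_designated' (w : Sym2 (Fin n) → unitInterval) (o b a₁ a₂ a₃ : Fin n)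
    (h12 : a₁ ≠ a₂) (h13 : a₁ ≠ a₃) (h23 : a₂ ≠ a₃)
    (hP₁₂ : 0 < (prodBernoulli w).real ((openConn a₁ a₃)ᶜ ∩ (openConn a₂ a₃)ᶜ : Set (BondConfig (Fin n))))
    (hP₁ : 0 < (prodBernoulli w).real ((openConn a₁ a₂)ᶜ ∩ (openConn a₁ a₃)ᶜ : Set (BondConfig (Fin n))))
    (hP₂ : 0 < (prodBernoulli w).real ((openConn a₂ a₁)ᶜ ∩ (openConn a₂ a₃)ᶜ : Set (BondConfig (Fin n))))
    (hcert : 0 ≤ (prodBernoulli w).real ((openConn a₁ a₂)ᶜ ∩ (openConn a₁ a₃)ᶜ ∩ openConn a₁ o)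
          * (prodBernoulli w).real ((openConn a₂ a₁)ᶜ ∩ (openConn a₂ a₃)ᶜ : Set (BondConfig (Fin n)))
          * ((prodBernoulli w).real (openConn a₁ b) - (prodBernoulli w).real (openConn a₃ b))
        + (prodBernoulli w).real ((openConn a₂ a₁)ᶜ ∩ (openConn a₂ a₃)ᶜ ∩ openConn a₂ o)
          * (prodBernoulli w).real ((openConn a₁ a₂)ᶜ ∩ (openConn a₁ a₃)ᶜ : Set (BondConfig (Fin n)))
          * ((prodBernoulli w).real (openConn a₂ b) - (prodBernoulli w).real (openConn a₃ b)))
    (hgood : (prodBernoulli w).real (openConn b a₃ ∩ (openConn b a₁)ᶜ ∩ (openConn b a₂)ᶜ) ≤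
      (prodBernoulli w).real (openConn b a₁ ∩ openConn b a₂ ∩ (openConn b a₃)ᶜ)) :
    (prodBernoulli w).real ((openConn o a₁ ∪ openConn o a₂ ∪ openConn o a₃) ∩ openConn a₃ b) ≤
      (prodBernoulli w).real ((openConn o a₁ ∪ openConn o a₂ ∪ openConn o a₃) ∩ openConn o b) :=
  knThm2_designated stub_bhkSets.1 stub_bhkSets.2 (stub_knLemma2 stub_bhkSets) w o b a₁ a₂ a₃ h12 h13 h23
    hP₁₂ hP₁ hP₂ hcert hgood

/-- **Block form: the designated-pocket kernel for three relays from the KN-Theorem-2 certificate.**  In the glued weighting `u/S`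
with an observer `s₀ ∈ S`, relays `a₁, a₂` and designation `a₀`:  `μ_{u/S}((s₀↔a₁ ∪ s₀↔a₂ ∪ s₀↔a₀) ∩ (a₀↔b)) ≤ μ_{u/S}(s₀↔b)`.
[cite: KozmaNitzan2024, Theorem 2 (§3.2, pp. 8–9), Question 9 p. 36] -/
theorem dKernel_three_of_knThm2 (u : Sym2 (Fin n) → unitInterval) (S : Finset (Fin n)) (s₀ b a₁ a₂ a₀ : Fin n)
    (h12 : a₁ ≠ a₂) (h10 : a₁ ≠ a₀) (h20 : a₂ ≠ a₀)
    (hP₁₂ : 0 < (prodBernoulli (fun e : Sym2 (Fin n) => if (∀ y ∈ e, y ∈ S) ∧ ¬ e.IsDiag then 1 else u e)).real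
      ((openConn a₁ a₀)ᶜ ∩ (openConn a₂ a₀)ᶜ : Set (BondConfig (Fin n))))
    (hP₁ : 0 < (prodBernoulli (fun e : Sym2 (Fin n) => if (∀ y ∈ e, y ∈ S) ∧ ¬ e.IsDiag then 1 else u e)).real
      ((openConn a₁ a₂)ᶜ ∩ (openConn a₁ a₀)ᶜ : Set (BondConfig (Fin n))))
    (hP₂ : 0 < (prodBernoulli (fun e : Sym2 (Fin n) => if (∀ y ∈ e, y ∈ S) ∧ ¬ e.IsDiag then 1 else u e)).real
      ((openConn a₂ a₁)ᶜ ∩ (openConn a₂ a₀)ᶜ : Set (BondConfig (Fin n))))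
    (hcert : 0 ≤ (prodBernoulli (fun e : Sym2 (Fin n) => if (∀ y ∈ e, y ∈ S) ∧ ¬ e.IsDiag then 1 else u e)).real
            ((openConn a₁ a₂)ᶜ ∩ (openConn a₁ a₀)ᶜ ∩ openConn a₁ s₀)
          * (prodBernoulli (fun e : Sym2 (Fin n) => if (∀ y ∈ e, y ∈ S) ∧ ¬ e.IsDiag then 1 else u e)).real
            ((openConn a₂ a₁)ᶜ ∩ (openConn a₂ a₀)ᶜ : Set (BondConfig (Fin n)))
          * ((prodBernoulli (fun e : Sym2 (Fin n) => if (∀ y ∈ e, y ∈ S) ∧ ¬ e.IsDiag then 1 else u e)).real (openConn a₁ b)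
              - (prodBernoulli (fun e : Sym2 (Fin n) => if (∀ y ∈ e, y ∈ S) ∧ ¬ e.IsDiag then 1 else u e)).real (openConn a₀ b))
        + (prodBernoulli (fun e : Sym2 (Fin n) => if (∀ y ∈ e, y ∈ S) ∧ ¬ e.IsDiag then 1 else u e)).real
            ((openConn a₂ a₁)ᶜ ∩ (openConn a₂ a₀)ᶜ ∩ openConn a₂ s₀)
          * (prodBernoulli (fun e : Sym2 (Fin n) => if (∀ y ∈ e, y ∈ S) ∧ ¬ e.IsDiag then 1 else u e)).real
            ((openConn a₁ a₂)ᶜ ∩ (openConn a₁ a₀)ᶜ : Set (BondConfig (Fin n)))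
          * ((prodBernoulli (fun e : Sym2 (Fin n) => if (∀ y ∈ e, y ∈ S) ∧ ¬ e.IsDiag then 1 else u e)).real (openConn a₂ b)
              - (prodBernoulli (fun e : Sym2 (Fin n) => if (∀ y ∈ e, y ∈ S) ∧ ¬ e.IsDiag then 1 else u e)).real (openConn a₀ b)))
    (hgood : (prodBernoulli (fun e : Sym2 (Fin n) => if (∀ y ∈ e, y ∈ S) ∧ ¬ e.IsDiag then 1 else u e)).real
        (openConn b a₀ ∩ (openConn b a₁)ᶜ ∩ (openConn b a₂)ᶜ) ≤
      (prodBernoulli (fun e : Sym2 (Fin n) => if (∀ y ∈ e, y ∈ S) ∧ ¬ e.IsDiag then 1 else u e)).real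
        (openConn b a₁ ∩ openConn b a₂ ∩ (openConn b a₀)ᶜ)) :
    (prodBernoulli (fun e : Sym2 (Fin n) => if (∀ y ∈ e, y ∈ S) ∧ ¬ e.IsDiag then 1 else u e)).real
        ((openConn s₀ a₁ ∪ openConn s₀ a₂ ∪ openConn s₀ a₀) ∩ openConn a₀ b)
      ≤ (prodBernoulli (fun e : Sym2 (Fin n) => if (∀ y ∈ e, y ∈ S) ∧ ¬ e.IsDiag then 1 else u e)).real (openConn s₀ b) := by
  refine le_trans (knThm2_designated' _ s₀ b a₁ a₂ a₀ h12 h10 h20 hP₁₂ hP₁ hP₂ hcert hgood) ?_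
  exact measureReal_mono Set.inter_subset_right (measure_ne_top _ _)

end

end Summit.CriticalPhenomena.PercolationContinuityZ3.Theorems
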